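import Summits.QuantumFields.YangMills.Theorems.AllWindowsColdBoxBulkMidSandwichLocalisedBL
import Summits.QuantumFields.YangMills.Theorems.SandwichVariancePinchingFloorWhitening

/-!
# LOCALISED Brascamp–Lieb for linear statistics — the `H₀`-metric statement
# (crux idea `logconcave-core-extension` on ⟨stmt-QuantumFields-24006⟩, piece P5′ at the LOCAL constant, card's metric)

`bl_linear_localised_posDef`: `H₀ ≻ 0`, `A ∈ C²` with the two-sided sandwich `(1±δ)hᵀH₀h` (`δ < 1`), a measurable `K'`
on which the LOCAL Hessian floor `(1−r')vᵀH₀v ≤ D²A(x)(v,v)` holds (`r' < 1`); then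
`(∫(x·b)²e^{−A})Z − (∫(x·b)e^{−A})² ≤ bᵀH₀⁻¹b·((1−r')⁻¹∫_{K'}e^{−A} + (1−δ)⁻¹(Z − ∫_{K'}e^{−A}))·Z`.
Whitening `x = P⁻¹y`, `P = H₀^{1/2}`: the Hessian of `Ψ = A∘P⁻¹` along `u` at `y` is the Hessian of `A` along `P⁻¹u` at
`P⁻¹y` (`hess_conj`, by uniqueness of one-dimensional derivatives along the common line — no operator calculus), the
set `K'` becomes `P⁻¹ ⁻¹' K'`, all integrals pick up the same Jacobian (squared on both sides).

HONEST SCOPE.  Free-hands work of the LEAD seat of ⟨stmt-QuantumFields-24006⟩ (FCL lineage) on an ingredient of an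
UN-TRIAGED crux idea card; classical log-concave probability.  No stub of LINE-18, no crux, rung or summit is proved; the
Yang–Mills mass gap is NOT proved by any of this.
-/

noncomputable section

namespace Summit.QuantumFields.YangMills.Theorems.SandwichVariancePinching

open MeasureTheory Real Filter Topology Set Matrix
open Summit.QuantumFields.YangMills.Cruxes.TransportCovarianceTransfer

variable {n : ℕ}

/-- HESSIAN UNDER A LINEAR CHANGE OF FRAME, diagonal entries: for `A ∈ C²` and an invertible `Q`,
`D²(A∘Q)(y)(u,u) = D²A(Qy)(Qu,Qu)` (both are the second derivative of `s ↦ A(Qy + sQu)` at `0`). [folklore] -/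
theorem hess_conj {A : (Fin n → ℝ) → ℝ} (hA : ContDiff ℝ 2 A) (Q : Matrix (Fin n) (Fin n) ℝ)
    (y u : Fin n → ℝ) :
    fderiv ℝ (fderiv ℝ (fun z => A (Q *ᵥ z))) y u u = fderiv ℝ (fderiv ℝ A) (Q *ᵥ y) (Q *ᵥ u) (Q *ᵥ u) := by
  have hΨ : ContDiff ℝ 2 (fun z => A (Q *ᵥ z)) := hA.comp (Matrix.mulVecLin Q).toContinuousLinearMap.contDiff
  -- first derivatives along the line agree
  have hline : ∀ s : ℝ, Q *ᵥ (y + s • u) = Q *ᵥ y + s • (Q *ᵥ u) := fun s => by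
    rw [Matrix.mulVec_add, Matrix.mulVec_smul]
  have h1 : ∀ s : ℝ, fderiv ℝ (fun z => A (Q *ᵥ z)) (y + s • u) u = fderiv ℝ A (Q *ᵥ y + s • (Q *ᵥ u)) (Q *ᵥ u) := by
    intro s
    have ha := meanMode_hasDerivAt_comp_path hΨ y u s
    have hb := meanMode_hasDerivAt_comp_path hA (Q *ᵥ y) (Q *ᵥ u) s
    have e : (fun t : ℝ => (fun z => A (Q *ᵥ z)) (y + t • u)) = fun t => A (Q *ᵥ y + t • (Q *ᵥ u)) := by
      funext t; simp only [hline]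
    rw [e] at ha
    exact ha.unique hb
  -- second derivatives along the line agree
  have ha := meanMode_hasDerivAt_fderiv_comp_path hΨ y u u 0
  have hb := meanMode_hasDerivAt_fderiv_comp_path hA (Q *ᵥ y) (Q *ᵥ u) (Q *ᵥ u) 0
  have e : (fun s : ℝ => fderiv ℝ (fun z => A (Q *ᵥ z)) (y + s • u) u) =
      fun s => fderiv ℝ A (Q *ᵥ y + s • (Q *ᵥ u)) (Q *ᵥ u) := by
    funext s; exact h1 s
  rw [e] at ha
  have h := ha.unique hb
  simpa using h

/-- **LOCALISED BRASCAMP–LIEB, `H₀` metric**: see the module docstring. [cite: BrascampLieb1976, Thm 4.1 — via the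
tree's `bl_wholeSpace_raw`] -/
theorem bl_linear_localised_posDef {H₀ : Matrix (Fin n) (Fin n) ℝ} (hH₀ : H₀.PosDef)
    {A : (Fin n → ℝ) → ℝ} (hA : ContDiff ℝ 2 A) {δ : ℝ} (hδ1 : δ < 1)
    (hsw : ∀ x h : Fin n → ℝ, (1 - δ) * (h ⬝ᵥ H₀.mulVec h) ≤ A (x + h) + A (x - h) - 2 * A x ∧
      A (x + h) + A (x - h) - 2 * A x ≤ (1 + δ) * (h ⬝ᵥ H₀.mulVec h)) (b : Fin n → ℝ)
    {K' : Set (Fin n → ℝ)} (hK' : MeasurableSet K') {r' : ℝ} (hr' : r' < 1)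
    (hloc : ∀ x ∈ K', ∀ v : Fin n → ℝ, (1 - r') * (v ⬝ᵥ H₀.mulVec v) ≤ fderiv ℝ (fderiv ℝ A) x v v) :
    (∫ x, (x ⬝ᵥ b) ^ 2 * exp (-A x)) * (∫ x, exp (-A x)) - (∫ x, (x ⬝ᵥ b) * exp (-A x)) ^ 2 ≤
      (b ⬝ᵥ H₀⁻¹.mulVec b) * ((1 - r')⁻¹ * (∫ x in K', exp (-A x)) +
        (1 - δ)⁻¹ * ((∫ x, exp (-A x)) - ∫ x in K', exp (-A x))) * ∫ x, exp (-A x) := by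
  obtain ⟨P, hPs, hP, hPP⟩ := exists_symm_sqrt hH₀
  have hQs : P⁻¹.IsSymm := isSymm_inv hPs
  have hQQ : P⁻¹ * P⁻¹ = H₀⁻¹ := by rw [← Matrix.mul_inv_rev, hPP]
  have hQdet : (P⁻¹).det ≠ 0 := by
    rw [Matrix.det_nonsing_inv, Ring.inverse_eq_inv']
    exact inv_ne_zero hP
  set Ψ : (Fin n → ℝ) → ℝ := fun y => A (P⁻¹ *ᵥ y) with hΨ
  have hΨ2 : ContDiff ℝ 2 Ψ := hA.comp (Matrix.mulVecLin P⁻¹).toContinuousLinearMap.contDiff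
  have hswΨ : ∀ y k : Fin n → ℝ, (1 - δ) * (k ⬝ᵥ k) ≤ Ψ (y + k) + Ψ (y - k) - 2 * Ψ y ∧
      Ψ (y + k) + Ψ (y - k) - 2 * Ψ y ≤ (1 + δ) * (k ⬝ᵥ k) := fun y k => sandwich_conj hPs hP hPP hsw y k
  set bt : Fin n → ℝ := P⁻¹ *ᵥ b with hbt
  set Kt : Set (Fin n → ℝ) := (fun y => P⁻¹ *ᵥ y) ⁻¹' K' with hKt
  have hKtm : MeasurableSet Kt :=
    hK'.preimage (Matrix.mulVecLin P⁻¹).toContinuousLinearMap.continuous.measurable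
  -- local floor in the whitened frame
  have hlocΨ : ∀ y ∈ Kt, ∀ u : Fin n → ℝ, (1 - r') * (u ⬝ᵥ u) ≤ fderiv ℝ (fderiv ℝ Ψ) y u u := by
    intro y hy u
    have h := hloc (P⁻¹ *ᵥ y) hy (P⁻¹ *ᵥ u)
    rw [quadForm_inv_mulVec hPs hP hPP] at h
    have e := hess_conj hA P⁻¹ y u
    simp only [hΨ]
    rw [e]
    exact h
  have key := bl_linear_localised hΨ2 hδ1 hswΨ bt hKtm hr' hlocΨ
  -- change variables back
  have hdot : ∀ x : Fin n → ℝ, (P⁻¹ *ᵥ x) ⬝ᵥ b = x ⬝ᵥ bt := fun x => by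
    rw [hbt, dotProduct_mulVec_of_isSymm hQs x b]
  set J : ℝ := |(P⁻¹).det|⁻¹ with hJ
  have hJpos : 0 < J := by rw [hJ]; exact inv_pos.mpr (abs_pos.mpr hQdet)
  have c0 := integral_comp_mulVec hQdet (fun x => exp (-A x))
  have c1 := integral_comp_mulVec hQdet (fun x => (x ⬝ᵥ b) * exp (-A x))
  have c2 := integral_comp_mulVec hQdet (fun x => (x ⬝ᵥ b) ^ 2 * exp (-A x))
  have cK := integral_comp_mulVec hQdet (fun x => K'.indicator (fun x => exp (-A x)) x)
  simp only [hdot] at c1 c2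
  have hind : ∀ y, K'.indicator (fun x => exp (-A x)) (P⁻¹ *ᵥ y) = Kt.indicator (fun y => exp (-Ψ y)) y := by
    intro y
    rw [hKt]
    exact (Set.indicator_comp_right (fun y => P⁻¹ *ᵥ y) (g := fun x => exp (-A x))).symm
  simp only [hind] at cK
  rw [integral_indicator hKtm, integral_indicator hK'] at cK
  -- `cK : ∫_{Kt} e^{−Ψ} = J * ∫_{K'} e^{−A}`, `c0 : ∫ e^{−Ψ} = J * Z`, `c1, c2` likewise
  have hZΨ : (∫ y, exp (-Ψ y)) = J * ∫ x, exp (-A x) := c0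
  have hMΨ : (∫ y, (y ⬝ᵥ bt) * exp (-Ψ y)) = J * ∫ x, (x ⬝ᵥ b) * exp (-A x) := c1
  have hIΨ : (∫ y, (y ⬝ᵥ bt) ^ 2 * exp (-Ψ y)) = J * ∫ x, (x ⬝ᵥ b) ^ 2 * exp (-A x) := c2
  have hKΨ : (∫ y in Kt, exp (-Ψ y)) = J * ∫ x in K', exp (-A x) := cK
  have hbb : bt ⬝ᵥ bt = b ⬝ᵥ H₀⁻¹ *ᵥ b := by rw [hbt]; exact conj_dotProduct_conj hQs hQQ b b
  rw [hZΨ, hMΨ, hIΨ, hKΨ, hbb] at key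
  -- divide by `J² > 0`
  have hJ2 : 0 < J ^ 2 := pow_pos hJpos 2
  have key' : J ^ 2 * ((∫ x, (x ⬝ᵥ b) ^ 2 * exp (-A x)) * (∫ x, exp (-A x)) -
      (∫ x, (x ⬝ᵥ b) * exp (-A x)) ^ 2) ≤
      J ^ 2 * ((b ⬝ᵥ H₀⁻¹ *ᵥ b) * ((1 - r')⁻¹ * (∫ x in K', exp (-A x)) +
        (1 - δ)⁻¹ * ((∫ x, exp (-A x)) - ∫ x in K', exp (-A x))) * ∫ x, exp (-A x)) := by
    have e1 : J * (∫ x, (x ⬝ᵥ b) ^ 2 * exp (-A x)) * (J * ∫ x, exp (-A x)) -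
        (J * ∫ x, (x ⬝ᵥ b) * exp (-A x)) ^ 2 =
        J ^ 2 * ((∫ x, (x ⬝ᵥ b) ^ 2 * exp (-A x)) * (∫ x, exp (-A x)) -
          (∫ x, (x ⬝ᵥ b) * exp (-A x)) ^ 2) := by ring
    have e2 : (b ⬝ᵥ H₀⁻¹ *ᵥ b) * ((1 - r')⁻¹ * (J * ∫ x in K', exp (-A x)) +
        (1 - δ)⁻¹ * (J * (∫ x, exp (-A x)) - J * ∫ x in K', exp (-A x))) * (J * ∫ x, exp (-A x)) =
        J ^ 2 * ((b ⬝ᵥ H₀⁻¹ *ᵥ b) * ((1 - r')⁻¹ * (∫ x in K', exp (-A x)) +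
          (1 - δ)⁻¹ * ((∫ x, exp (-A x)) - ∫ x in K', exp (-A x))) * ∫ x, exp (-A x)) := by ring
    rw [← e1, ← e2]
    exact key
  exact le_of_mul_le_mul_left key' hJ2

end Summit.QuantumFields.YangMills.Theorems.SandwichVariancePinching

end
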